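import Literature.NumberTheory.EllipticCurves.KatzPAdicLFunctionCMField
import Literature.NumberTheory.EllipticCurves.ZpExtensionRestrictProofs
import Literature.NumberTheory.GaloisRepresentations.GlobalArtinMapNormProofs
import HarnessLib

/-!
# The Katz–Hida–Tilouine branch of a CM field `L` along the BASE CHANGE of a `ℤ_p`-extension of a
# subfield `K ⊂ L`, indexed by the Hecke characters of `K` (Hsieh, J. reine angew. Math. 688 (2014),
# Prop. 4.9, on the points `λ · (φ ∘ N_{L/K})`): the `K′`-LINE frame, its bridge to `KatzCM.IsLine`,
# and the receptacle conversion `𝒪_{ℂ_p}⟦T₁⟧ (one-member family) → 𝒪_{ℂ_p}⟦T⟧`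

Topic `NumberTheory/EllipticCurves`; companion of `KatzPAdicLFunctionCMField.lean` (the frames
`KatzCM.IsMeasure` / `KatzCM.IsLine` of the `λ`-branch of the Katz–Hida–Tilouine measure of a CM field
`L` with a `p`-ordinary CM type, Hsieh's normalisation; its module docstring (T1)–(T8) is used and not
repeated). Requested by the lead prover of crux `EisensteinHeartFlatCMInertBadKPrime` (route
`BiquadraticEisensteinDescent`, `Summits/BirchSwinnertonDyer`; `LAYER2-VOCAB-BRIEF.md` item V1
"`IsKatzLineCM` — the Katz measure of `(L, Σ)` RESTRICTED TO THE `K′`-LINE through `ψ_L` … Body: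
`∀ (φ : HeckeCharacter K′) … φ unramified everywhere … ∀ r, IsPAdicAvatarOf ι φ r → FactorsThroughZp κ r
→ IntSeries.HasValueAt Q (avatarValueAt r γ − 1) (…)` … for the character `λ := ψ_L · (φ ∘ N_{L/K′})`").
STATEMENTS with small proofs; ONE named fact (`isPAdicAvatarOf_compRelNorm`, +1 declared debt, a
folklore compatibility, dischargeable); no `sorry`, no `instance`, no notation. Nothing here asserts
anything about any case of BSD.

## What is typed (binder by binder)

* (B1) `KatzCM.IsBaseChangeLine ι Σ_p S T κ γ λ ϑ C Ω Ω_p G` — for a subfield `K ⊂ L` with `L/K`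
  Galois (the tree's `HeckeCharacter.compRelNorm`, Cassels–Fröhlich VII Prop. 4.3, needs `IsGalois`),
  a `ℤ_p`-extension `κ` of `K` and `γ ∈ Γ_K`: the SAME display as `KatzCM.IsLine` (Hsieh, Crelle 688,
  Prop. 4.9 on the range of (T4): `χ = λρ`, `ρ` unramified everywhere, `k ≥ 1`) at the points
  `ρ := φ ∘ N_{L/K}`, `φ` a Hecke character of `K` UNRAMIFIED everywhere (then so is `ρ`,
  `compRelNorm_isUnramifiedAt_of_forall`), with a `p`-adic avatar `r` of `φ` OVER `K` factoring through
  `κ`, READ AT `T = r(γ) − 1` — binder for binder the shape of `IsHsiehLFunction ι 𝔭 κ γ f A Ω_K C Ω_p Q`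
  (whose points are the unramified `χ` over `K = K′` with avatar through `κ`), so that on the `K′`-line
  of a biquadratic CM field `L = K_CM·K′` a Hsieh witness `Q_H` and a Katz series `G` are evaluated at
  LITERALLY the same `(φ, r, γ)`; the branch character `λ` (e.g. `ψ_W ∘ N_{L/K_CM}` up to a norm
  twist) and `(k, κ)` stay general (`HasKatzType` of `λ·(φ ∘ N)`).
* (B2) THE BRIDGE `KatzCM.IsLine.isBaseChangeLine`: a line frame along the RESTRICTED extension
  `κ ∘ res : Γ_L → ℤ_p` (`ZpExtension.restrict`, surjective e.g. for `[L:K] = 2`, `p ≠ 2`: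
  `restrictOfFinrankEqTwo`) with generator `γ_L`, `κ(res γ_L) = κ(γ)`
  (`ZpExtension.restrict_apply_eq_of_isTopGenerator`), is a base-change-line frame along `(κ, γ)`:
  `FactorsThroughZp.restrictField` (`r|_{Γ_L}` factors through `κ ∘ res`),
  `avatarValueAt_restrictField_eq` (`r|_{Γ_L}(γ_L) = r(γ)`: `res γ_L · γ⁻¹ ∈ ker κ` is killed by `r`),
  and the avatar compatibility (B3). PROVED modulo (B3).
* (B3) `isPAdicAvatarOf_compRelNorm` — NAMED FACT (folklore; Cassels–Fröhlich VII §6.3 with Prop. 4.3,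
  Serre 1968 II §2.7): for `φ` unramified everywhere with avatar `r` (`IsPAdicAvatarOf ι φ r`), the
  avatar of `φ ∘ N_{L/K}` is `r|_{Γ_L}` (`FramedGaloisRep.restrictField`). Content: at `w ∤ p`,
  `r|_{Γ_L}(Frob_w^{geom}) = r(Frob_v^{geom})^{f(w|v)} = ι⁻¹(φ(ϖ_v))^{f} = ι⁻¹((φ∘N)(ϖ_w))`
  (`HeckeCharacter.compRelNorm_valueAtUniformizer` gives the last equality at `v` unramified in `L`).
  Not proved here: the tree has the DESCENT direction (`FramedGaloisRep.hasFrobCharpolyAt_of_restrictField`,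
  `isUnramifiedAt_of_restrictField`) and the `f = 1` ascent, not the Frobenius-power ascent for
  `f(w|v) > 1` nor the norm of a uniformiser at places ramified in `L/K`. +1 declared debt.
* (B4) RECEPTACLES: `MvIntSeries.toLine : 𝒪_{ℂ_p}⟦T₀⟧ → 𝒪_{ℂ_p}⟦T⟧` (one-member family ↦ one
  variable, coefficientwise) with `MvIntSeries.hasValueAt_iff_toLine` (reindexing `Fin 1 →₀ ℕ ≃ ℕ`);
  hence `KatzCM.IsMeasure.isLine_toLine` (an `n = 1` family frame IS a line frame) and
  `KatzCM.exists_isLine`: granted `hsieh2014mu_prop49_exists_isMeasure`, under its hypotheses, every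
  `ℤ_p`-line of `Γ_L` carries a frame `IsLine` — and then, by (B2), every base-change line carries a
  frame `IsBaseChangeLine` (granted (B3)).

## What is NOT typed

The discharge of (B3); any statement comparing `IsBaseChangeLine` with `IsHsiehLFunction`
(the route's (E1a) "Katz–Hsieh factorisation up to a non-zero constant" — a separate named fact /
theorem for the CM form `θ_ψ`); the choice `λ = ψ_W ∘ N_{L/K_CM}` and the biquadratic setting
themselves (route-posited objects, `Theorems/BiquadraticEisensteinDescentDefs.lean`).

## References

* [Hsieh2014mu] M.-L. Hsieh, J. reine angew. Math. 688 (2014), Prop. 4.9 (§4.8), §1 (the pull-back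
  `𝓛⁻_{χ,Σ}` along a branch), §5.1.
* [Washington1997] L. Washington, *Introduction to Cyclotomic Fields*, §7.1 (`Λ ≅ ℤ_p⟦T⟧`), §13.1–13.2
  (`ℤ_p`-extensions, `K_∞L/L`, topological generators).
* [CasselsFrohlichANT1967] Cassels–Fröhlich, *Algebraic Number Theory*, Ch. VII (Tate), Prop. 4.3 and
  §6.3 (norm compatibility of the reciprocity map); [SerreAbelianLadic1968] Ch. II §2.7 (avatars).
-/

noncomputable section

open scoped Classical nonZeroDivisors
open NumberField IsDedekindDomain Field Polynomial
open Literature.NumberTheory.GaloisRepresentations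

namespace Literature.NumberTheory.EllipticCurves

universe u

/-! ### §1. The receptacle conversion `MvPowerSeries (Fin 1) 𝒪 → PowerSeries 𝒪` and its values -/

section OneVariable

variable {p : ℕ} [Fact p.Prime]

/-- **The one-variable series of a series in a one-member family of variables**: the coefficient of
`T^k` is the coefficient of `T₀^k` (`Fin 1 →₀ ℕ ∋ single 0 k`). The receptacles `𝒪⟦T₀⟧` of
`KatzCM.IsMeasure` for `n = 1` and `𝒪⟦T⟧` of `KatzCM.IsLine` / `IsHsiehLFunction` are thereby
identified (`MvIntSeries.hasValueAt_iff_toLine`). [cite: Washington1997, §7.1 (`Λ ≅ ℤ_p⟦T⟧`, `γ ↦ 1 + T`)] -/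
def MvIntSeries.toLine (G : MvPowerSeries (Fin 1) (PadicComplexInt p)) :
    PowerSeries (PadicComplexInt p) :=
  PowerSeries.mk fun k ↦ MvPowerSeries.coeff (Finsupp.single 0 k) G

/-- Coefficients of `toLine`. [cite: Washington1997, §7.1] -/
@[simp] theorem MvIntSeries.coeff_toLine (G : MvPowerSeries (Fin 1) (PadicComplexInt p)) (k : ℕ) :
    PowerSeries.coeff k (MvIntSeries.toLine G) = MvPowerSeries.coeff (Finsupp.single 0 k) G := by
  simp [MvIntSeries.toLine]

/-- `Fin 1 →₀ ℕ` is `ℕ` via the value at `0` (every `e` is `single 0 (e 0)`).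
[cite: Washington1997, §7.1] -/
def MvIntSeries.finOneEquiv : (Fin 1 →₀ ℕ) ≃ ℕ where
  toFun e := e 0
  invFun k := Finsupp.single 0 k
  left_inv e := Finsupp.ext fun i ↦ by
    rw [Subsingleton.elim i 0, Finsupp.single_eq_same]
  right_inv k := Finsupp.single_eq_same

/-- **The value of a one-member-family series at `(x)` is the value of its one-variable series at
`x`** (reindexing the `HasSum` along `Fin 1 →₀ ℕ ≃ ℕ`). [cite: Washington1997, §7.1] -/
theorem MvIntSeries.hasValueAt_iff_toLine (G : MvPowerSeries (Fin 1) (PadicComplexInt p))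
    (x v : ℂ_[p]) :
    MvIntSeries.HasValueAt G (fun _ ↦ x) v ↔ IntSeries.HasValueAt (MvIntSeries.toLine G) x v := by
  unfold MvIntSeries.HasValueAt IntSeries.HasValueAt
  rw [← MvIntSeries.finOneEquiv.symm.hasSum_iff]
  refine Iff.of_eq (congrArg (fun f ↦ HasSum f v) ?_)
  funext k
  simp only [Function.comp_apply, MvIntSeries.finOneEquiv, Equiv.coe_fn_symm_mk,
    MvIntSeries.coeff_toLine, Finset.univ_unique, Fin.default_eq_zero, Finset.prod_singleton,
    Finsupp.single_eq_same]

end OneVariable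

/-! ### §2. The frame along the base change of a `ℤ_p`-extension of a subfield, indexed downstairs -/

section BaseChangeLine

variable {K L : Type} [Field K] [NumberField K] [Field L] [NumberField L] [Algebra K L]
  [IsGalois K L] {p : ℕ} [Fact p.Prime]

namespace KatzCM

/-- **The `λ`-branch of the Katz–Hida–Tilouine measure of `(L, Σ)` along the base change
`L·K_∞/L` of a `ℤ_p`-extension `κ` of a subfield `K ⊂ L` (`L/K` Galois), as a CHARACTERISING
PREDICATE on `G ∈ 𝒪_{ℂ_p}⟦T⟧` (`1 + T ↔ γ`, `γ ∈ Γ_K` a topological generator of `κ`), INDEXED BY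
THE HECKE CHARACTERS OF `K`** — the "`K′`-line" of a CM field `L ⊃ K′` (module docstring (B1)–(B4)):
for every Hecke character `φ` of `K` UNRAMIFIED at all finite places with a `p`-adic avatar `r`
(`IsPAdicAvatarOf ι φ r`) factoring through `κ` (`FactorsThroughZp κ r`), such that
`χ := λ · (φ ∘ N_{L/K})` (the tree's `HeckeCharacter.compRelNorm`) has infinity type `kΣ + κ(1 − c)`,
`k ≥ 1` (`HasKatzType`), and every entire continuation `hL` of `L(χ, s)`, the value of `G` at
`T = r(γ) − 1` is `ι⁻¹(interpolationValue ι Σ_p S T λ (φ ∘ N) k κ ϑ C Ω (L(χ,0))) · ∏_w Ω_{p,w}^{k+2κ_w}`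
— the SAME display as `KatzCM.IsLine` at `ρ = φ ∘ N_{L/K}` (which is unramified everywhere,
`compRelNorm_isUnramifiedAt_of_forall`), read at the DOWNSTAIRS evaluation point, exactly as
`IsHsiehLFunction ι 𝔭 κ γ …` reads its values (same `(φ, r, γ)`; there `φ` is called `χ`). Parameters
as in `IsLine` with `(κ₁, γ_L)` replaced by `(κ, γ)` over `K`. A predicate, not a construction.
[cite: Hsieh2014mu, Prop. 4.9 (§4.8) and §1 (Introduction: `𝓛⁻_{χ,Σ}`, pull-back along a branch)] -/
def IsBaseChangeLine (ι : PadicAlgCl p ≃+* ℂ) (Sp S T : Finset (HeightOneSpectrum (𝓞 L)))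
    (κ : ZpExtension K p) (γ : absoluteGaloisGroup K) (lam : HeckeCharacter L) (ϑ : L) (C : ℂ)
    (Ω : InfinitePlace L → ℂ) (Ωp : InfinitePlace L → ℂ_[p]) (G : PowerSeries (PadicComplexInt p)) :
    Prop :=
  ∀ (φ : HeckeCharacter K) (r : FramedGaloisRep K (PadicAlgCl p) 1) (k : ℕ)
    (κ_ : InfinitePlace L → ℕ),
    IsPAdicAvatarOf ι φ r → FactorsThroughZp κ r → 1 ≤ k →
    HasKatzType ι Sp (lam * φ.compRelNorm L) k κ_ →
    (∀ v : HeightOneSpectrum (𝓞 K), φ.IsUnramifiedAt v) →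
    ∀ hL : LFunction.HasEntireContinuation (heckeLFunction (lam * φ.compRelNorm L)),
      IntSeries.HasValueAt G (avatarValueAt r γ - 1)
        (((ι.symm (interpolationValue ι Sp S T lam (φ.compRelNorm L) k κ_ ϑ C Ω
            (hL.continuation 0)) : PadicAlgCl p) : ℂ_[p]) * ∏ w, Ωp w ^ (k + 2 * κ_ w))

/-- Unfolding `IsBaseChangeLine` at one character of the typed range.
[cite: Hsieh2014mu, Prop. 4.9 (§4.8)] -/
theorem IsBaseChangeLine.hasValueAt {ι : PadicAlgCl p ≃+* ℂ}
    {Sp S T : Finset (HeightOneSpectrum (𝓞 L))} {κ : ZpExtension K p} {γ : absoluteGaloisGroup K}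
    {lam : HeckeCharacter L} {ϑ : L} {C : ℂ} {Ω : InfinitePlace L → ℂ}
    {Ωp : InfinitePlace L → ℂ_[p]} {G : PowerSeries (PadicComplexInt p)}
    (hG : IsBaseChangeLine ι Sp S T κ γ lam ϑ C Ω Ωp G)
    {φ : HeckeCharacter K} {r : FramedGaloisRep K (PadicAlgCl p) 1} {k : ℕ}
    {κ_ : InfinitePlace L → ℕ} (hr : IsPAdicAvatarOf ι φ r) (hκ : FactorsThroughZp κ r)
    (hk : 1 ≤ k) (hinf : HasKatzType ι Sp (lam * φ.compRelNorm L) k κ_)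
    (hunr : ∀ v : HeightOneSpectrum (𝓞 K), φ.IsUnramifiedAt v)
    (hL : LFunction.HasEntireContinuation (heckeLFunction (lam * φ.compRelNorm L))) :
    IntSeries.HasValueAt G (avatarValueAt r γ - 1)
      (((ι.symm (interpolationValue ι Sp S T lam (φ.compRelNorm L) k κ_ ϑ C Ω
          (hL.continuation 0)) : PadicAlgCl p) : ℂ_[p]) * ∏ w, Ωp w ^ (k + 2 * κ_ w)) :=
  hG φ r k κ_ hr hκ hk hinf hunr hL

/-- The prescribed value is unique. [cite: Hsieh2014mu, Prop. 4.9 (§4.8)] -/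
theorem IsBaseChangeLine.eq_of_hasValueAt {ι : PadicAlgCl p ≃+* ℂ}
    {Sp S T : Finset (HeightOneSpectrum (𝓞 L))} {κ : ZpExtension K p} {γ : absoluteGaloisGroup K}
    {lam : HeckeCharacter L} {ϑ : L} {C : ℂ} {Ω : InfinitePlace L → ℂ}
    {Ωp : InfinitePlace L → ℂ_[p]} {G : PowerSeries (PadicComplexInt p)}
    (hG : IsBaseChangeLine ι Sp S T κ γ lam ϑ C Ω Ωp G)
    {φ : HeckeCharacter K} {r : FramedGaloisRep K (PadicAlgCl p) 1} {k : ℕ}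
    {κ_ : InfinitePlace L → ℕ} (hr : IsPAdicAvatarOf ι φ r) (hκ : FactorsThroughZp κ r)
    (hk : 1 ≤ k) (hinf : HasKatzType ι Sp (lam * φ.compRelNorm L) k κ_)
    (hunr : ∀ v : HeightOneSpectrum (𝓞 K), φ.IsUnramifiedAt v)
    (hL : LFunction.HasEntireContinuation (heckeLFunction (lam * φ.compRelNorm L))) {x : ℂ_[p]}
    (hx : IntSeries.HasValueAt G (avatarValueAt r γ - 1) x) :
    x = ((ι.symm (interpolationValue ι Sp S T lam (φ.compRelNorm L) k κ_ ϑ C Ω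
          (hL.continuation 0)) : PadicAlgCl p) : ℂ_[p]) * ∏ w, Ωp w ^ (k + 2 * κ_ w) :=
  hx.unique (hG.hasValueAt hr hκ hk hinf hunr hL)

end KatzCM

/-! ### §3. The bridge: characters, avatars and evaluation points under restriction to `Γ_L` -/

/-- `φ ∘ N_{L/K}` is unramified everywhere if `φ` is. [cite: CasselsFrohlichANT1967, Ch. VII Prop. 4.3] -/
theorem compRelNorm_isUnramifiedAt_of_forall {φ : HeckeCharacter K}
    (hφ : ∀ v : HeightOneSpectrum (𝓞 K), φ.IsUnramifiedAt v) (w : HeightOneSpectrum (𝓞 L)) :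
    (φ.compRelNorm L).IsUnramifiedAt w :=
  φ.compRelNorm_isUnramifiedAt (hφ _)

omit [NumberField K] [IsGalois K L] in
/-- A character of `Γ_K` factoring through `κ` restricts to a character of `Γ_L` factoring through
the restricted extension `κ ∘ res`. [cite: Washington1997, §13.1] -/
theorem FactorsThroughZp.restrictField {A : Type*} [CommRing A] [TopologicalSpace A]
    {κ : ZpExtension K p} {r : FramedGaloisRep K A 1} (h : FactorsThroughZp κ r)
    (hs : Function.Surjective (κ.toContinuousMonoidHom.comp (absGaloisRestrict K L))) :
    FactorsThroughZp (κ.restrict L hs) (r.restrictField L) := by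
  intro σ hσ
  rw [ZpExtension.restrict_apply] at hσ
  rw [FramedGaloisRep.restrictField_apply]
  exact h _ hσ

omit [NumberField K] [NumberField L] [IsGalois K L] in
/-- **Evaluation points match**: if `r` factors through `κ` and `κ(res γ_L) = κ(γ)` (e.g. `γ`, `γ_L`
topological generators of `κ` and of `κ ∘ res`, `ZpExtension.restrict_apply_eq_of_isTopGenerator`),
then `r|_{Γ_L}(γ_L) = r(γ)` in `ℂ_p`. [cite: Washington1997, §13.2] -/
theorem avatarValueAt_restrictField_eq {κ : ZpExtension K p}
    {r : FramedGaloisRep K (PadicAlgCl p) 1} (h : FactorsThroughZp κ r)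
    {γ : absoluteGaloisGroup K} {γL : absoluteGaloisGroup L}
    (hγ : κ (absGaloisRestrict K L γL) = κ γ) :
    avatarValueAt (r.restrictField L) γL = avatarValueAt r γ := by
  have hker : κ (absGaloisRestrict K L γL * γ⁻¹) = 1 := by
    rw [map_mul, map_inv, hγ, mul_inv_cancel]
  have h1 : r (absGaloisRestrict K L γL * γ⁻¹) = 1 := h _ hker
  have h2 : r.restrictField L γL = r (absGaloisRestrict K L γL * γ⁻¹) * r γ := by
    rw [FramedGaloisRep.restrictField_apply, ← map_mul, inv_mul_cancel_right]
  rw [avatarValueAt, avatarValueAt, h2, h1, one_mul]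

/-- **The `p`-adic avatar of `φ ∘ N_{L/K}` is the restriction to `Γ_L` of the avatar of `φ`** (for
`φ` unramified everywhere; `L/K` finite Galois): the standard compatibility of the (geometrically
normalised) reciprocity map with restriction/norm, `rec_L = rec_K ∘ N_{L/K}` on `Gal(K^{ab}L/L)`
(Cassels–Fröhlich VII §6 / Serre 1968 II §2.7): at `w ∤ p` unramified for `φ ∘ N`, `r|_{Γ_L}` is
unramified and `r|_{Γ_L}(Frob_w^{geom}) = r(Frob_v^{geom})^{f(w|v)} = ι⁻¹(φ(ϖ_v))^{f} =
ι⁻¹((φ ∘ N)(ϖ_w))`. A NAMED FACT (`def … : Prop`): the Frobenius-power bookkeeping for `f(w|v) > 1`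
and the norm of a uniformiser at places ramified in `L/K` are not yet tree lemmas (the descent
direction is: `FramedGaloisRep.hasFrobCharpolyAt_of_restrictField`). Dischargeable; used only by the
bridge `KatzCM.IsLine.isBaseChangeLine`. [cite: CasselsFrohlichANT1967, Ch. VII §6.3 and Prop. 4.3 (norm compatibility of the reciprocity map)]
[cite: SerreAbelianLadic1968, Ch. II §2.7] -/
def isPAdicAvatarOf_compRelNorm : Prop :=
  ∀ {K L : Type} [Field K] [NumberField K] [Field L] [NumberField L] [Algebra K L] [IsGalois K L]
    {p : ℕ} [Fact p.Prime] (ι : PadicAlgCl p ≃+* ℂ) (φ : HeckeCharacter K)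
    (r : FramedGaloisRep K (PadicAlgCl p) 1),
    IsPAdicAvatarOf ι φ r → (∀ v : HeightOneSpectrum (𝓞 K), φ.IsUnramifiedAt v) →
      IsPAdicAvatarOf ι (φ.compRelNorm L) (r.restrictField L)

namespace KatzCM

/-- **THE BRIDGE.** An `IsLine` frame of `(L, Σ, λ)` along the restricted extension `κ ∘ res`
with generator `γ_L`, `κ(res γ_L) = κ(γ)`, IS a base-change-line frame along `(κ, γ)` — granted
the avatar compatibility `isPAdicAvatarOf_compRelNorm`: the point `φ` (over `K`) of the latter is
the point `ρ = φ ∘ N_{L/K}` (over `L`) of the former, with `r_ρ = r|_{Γ_L}` through `κ ∘ res` and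
`r_ρ(γ_L) = r(γ)`. [cite: Hsieh2014mu, Prop. 4.9 (§4.8) and §1 (Introduction)] [cite: Washington1997, §13.1–13.2] -/
theorem IsLine.isBaseChangeLine (hA : isPAdicAvatarOf_compRelNorm) {ι : PadicAlgCl p ≃+* ℂ}
    {Sp S T : Finset (HeightOneSpectrum (𝓞 L))} {κ : ZpExtension K p}
    (hs : Function.Surjective (κ.toContinuousMonoidHom.comp (absGaloisRestrict K L)))
    {γ : absoluteGaloisGroup K} {γL : absoluteGaloisGroup L}
    (hγ : κ (absGaloisRestrict K L γL) = κ γ)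
    {lam : HeckeCharacter L} {ϑ : L} {C : ℂ} {Ω : InfinitePlace L → ℂ}
    {Ωp : InfinitePlace L → ℂ_[p]} {G : PowerSeries (PadicComplexInt p)}
    (hG : IsLine ι Sp S T (κ.restrict L hs) γL lam ϑ C Ω Ωp G) :
    IsBaseChangeLine ι Sp S T κ γ lam ϑ C Ω Ωp G := by
  intro φ r k κ_ hr hκ hk hinf hunr hL
  have hr' : IsPAdicAvatarOf ι (φ.compRelNorm L) (r.restrictField L) := hA ι φ r hr hunr
  have hκ' : FactorsThroughZp (κ.restrict L hs) (r.restrictField L) :=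
    FactorsThroughZp.restrictField (L := L) hκ hs
  have hpt : avatarValueAt (r.restrictField L) γL = avatarValueAt r γ :=
    avatarValueAt_restrictField_eq hκ hγ
  rw [← hpt]
  exact hG (φ.compRelNorm L) (r.restrictField L) k κ_ hr' hκ' hk hinf
    (compRelNorm_isUnramifiedAt_of_forall hunr) hL

/-- The bridge for `[L : K] = 2`, `p ≠ 2` (`ZpExtension.restrictOfFinrankEqTwo`, the case of a
biquadratic CM field over an imaginary quadratic `K = K′`), with topological generators `γ`, `γ_L`.
[cite: Hsieh2014mu, Prop. 4.9 (§4.8)] [cite: Washington1997, §13.1–13.2] -/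
theorem IsLine.isBaseChangeLine_of_finrank_eq_two (hA : isPAdicAvatarOf_compRelNorm) (hp : p ≠ 2)
    (hL2 : Module.finrank K L = 2) {ι : PadicAlgCl p ≃+* ℂ}
    {Sp S T : Finset (HeightOneSpectrum (𝓞 L))} {κ : ZpExtension K p}
    {γ : absoluteGaloisGroup K} {γL : absoluteGaloisGroup L} (hγ : κ.IsTopGenerator γ)
    (hγL : (κ.restrictOfFinrankEqTwo hp L hL2).IsTopGenerator γL)
    {lam : HeckeCharacter L} {ϑ : L} {C : ℂ} {Ω : InfinitePlace L → ℂ}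
    {Ωp : InfinitePlace L → ℂ_[p]} {G : PowerSeries (PadicComplexInt p)}
    (hG : IsLine ι Sp S T (κ.restrictOfFinrankEqTwo hp L hL2) γL lam ϑ C Ω Ωp G) :
    IsBaseChangeLine ι Sp S T κ γ lam ϑ C Ω Ωp G := by
  have hγ' : κ (absGaloisRestrict K L γL) = κ γ := by
    have h := ZpExtension.restrictOfFinrankEqTwo_apply_eq_of_isTopGenerator hp κ L hL2 hγ hγL
    rwa [ZpExtension.restrictOfFinrankEqTwo_apply] at h
  exact IsLine.isBaseChangeLine hA _ hγ' hG

/-! ### §4. From the `n = 1` family frame to the line frames -/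

/-- **A one-member-family frame is a line frame for its one-variable series** (`toLine`).
[cite: Hsieh2014mu, Prop. 4.9 (§4.8)] [cite: Washington1997, §7.1] -/
theorem IsMeasure.isLine_toLine {ι : PadicAlgCl p ≃+* ℂ} {Sp S T : Finset (HeightOneSpectrum (𝓞 L))}
    {κ₁ : ZpExtension L p} {γ₁ : absoluteGaloisGroup L}
    {lam : HeckeCharacter L} {ϑ : L} {C : ℂ} {Ω : InfinitePlace L → ℂ}
    {Ωp : InfinitePlace L → ℂ_[p]} {G : MvPowerSeries (Fin 1) (PadicComplexInt p)}
    (hG : IsMeasure ι Sp S T (fun _ : Fin 1 ↦ κ₁) (fun _ ↦ γ₁) lam ϑ C Ω Ωp G) :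
    IsLine ι Sp S T κ₁ γ₁ lam ϑ C Ω Ωp (MvIntSeries.toLine G) := by
  intro ρ r k κ_ hr hκ hk hinf hunr hL
  have h := hG ρ r k κ_ hr ((factorsThroughFamily_one_iff κ₁ r).mpr hκ) hk hinf hunr hL
  exact (MvIntSeries.hasValueAt_iff_toLine G _ _).mp h

/-- **Existence on every `ℤ_p`-line of `Γ_L`**, granted the named fact
`hsieh2014mu_prop49_exists_isMeasure`, under its hypotheses: some `G ∈ 𝒪_{ℂ_p}⟦T⟧` with
`IsLine ι Σ_p S T κ₁ γ₁ λ ϑ C Ω Ω_p G` (with `C ≠ 0`, `Ω_w ≠ 0`, `‖Ω_{p,w}‖ = 1`).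
[cite: Hsieh2014mu, Prop. 4.9 (§4.8)] -/
theorem exists_isLine (h : hsieh2014mu_prop49_exists_isMeasure) (hp : 2 < p) [IsCMField L]
    (hunr : ¬ (p : ℤ) ∣ NumberField.discr (maximalRealSubfield L))
    {ι : PadicAlgCl p ≃+* ℂ} {Sp S T D : Finset (HeightOneSpectrum (𝓞 L))}
    (hSp : IsPAdicCMType p Sp) {ϑ : L} (hϑ₁ : ∀ σ : L →+* ℂ, (σ ϑ).re = 0)
    (hϑ₂ : ∀ σ : L →+* ℂ, InSigma ι Sp σ → 0 < (σ ϑ).im)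
    (hS : ∀ w ∈ S, ((p : ℕ) : 𝓞 L) ∉ w.asIdeal) (hTS : T ⊆ S)
    (hT : ∀ w ∈ T, IsCMField.complexConj L • w ≠ w ∧ IsCMField.complexConj L • w ∉ T)
    (hST : ∀ w ∈ S, IsCMField.complexConj L • w ≠ w → (w ∈ T ∨ IsCMField.complexConj L • w ∈ T))
    (hD₁ : primesOver L p ⊆ D) (hD₂ : S ⊆ D) (hD₃ : ∀ w ∈ S, IsCMField.complexConj L • w ∈ D)
    (hD₄ : ∀ w : HeightOneSpectrum (𝓞 L),
      w.asIdeal.ramificationIdx (𝓞 (maximalRealSubfield L)) ≠ 1 → w ∈ D)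
    (hd2 : ∀ w ∈ D, ordAt w (2 * ϑ) = differentExponentAt w) {lam : HeckeCharacter L}
    (hlam : ∀ w : HeightOneSpectrum (𝓞 L), w ∉ S → ((p : ℕ) : 𝓞 L) ∉ w.asIdeal →
      lam.IsUnramifiedAt w)
    {κ₁ : ZpExtension L p} {γ₁ : absoluteGaloisGroup L} (hγ : κ₁.IsTopGenerator γ₁) :
    ∃ (C : ℂ) (Ω : InfinitePlace L → ℂ) (Ωp : InfinitePlace L → ℂ_[p])
      (G : PowerSeries (PadicComplexInt p)),
      C ≠ 0 ∧ (∀ w, Ω w ≠ 0) ∧ (∀ w, ‖Ωp w‖ = 1) ∧ IsLine ι Sp S T κ₁ γ₁ lam ϑ C Ω Ωp G := by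
  obtain ⟨C, Ω, Ωp, G, hC, hΩ, hΩp, hG⟩ :=
    exists_isMeasure_one (S := S) (T := T) h hp hunr hSp hϑ₁ hϑ₂ hS hTS hT hST hD₁ hD₂ hD₃ hD₄
      hd2 hlam hγ
  exact ⟨C, Ω, Ωp, MvIntSeries.toLine G, hC, hΩ, hΩp, hG.isLine_toLine⟩

/-! ### §5. Existence on a base-change line (appended) -/

/-- **Existence of a frame on every base-change line**, granted the Katz–Hida–Tilouine existence fact
`hsieh2014mu_prop49_exists_isMeasure` AND the avatar compatibility `isPAdicAvatarOf_compRelNorm`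
((B3)), under the hypotheses of the former: for a subfield `K ⊂ L` (`L/K` Galois), a
`ℤ_p`-extension `κ` of `K` whose restriction `κ ∘ res` to `Γ_L` is surjective (e.g. `[L:K]` prime to
`p`), and topological generators `γ` of `κ`, `γ_L` of `κ ∘ res`, there are `C ≠ 0`, periods and
`G ∈ 𝒪_{ℂ_p}⟦T⟧` with `IsBaseChangeLine ι Σ_p S T κ γ λ ϑ C Ω Ω_p G` — `exists_isLine` on the line
`κ ∘ res`, then the bridge `IsLine.isBaseChangeLine` (`κ(res γ_L) = κ(γ)` as both are `1`). This is
the existence statement the sockets of the requesting line consume (a `K′`-indexed Katz series to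
compare with a Hsieh witness). [cite: Hsieh2014mu, Prop. 4.9 (§4.8)] [cite: Washington1997, §13.1–13.2] -/
theorem exists_isBaseChangeLine (h : hsieh2014mu_prop49_exists_isMeasure)
    (hA : isPAdicAvatarOf_compRelNorm) (hp : 2 < p) [IsCMField L]
    (hunr : ¬ (p : ℤ) ∣ NumberField.discr (maximalRealSubfield L))
    {ι : PadicAlgCl p ≃+* ℂ} {Sp S T D : Finset (HeightOneSpectrum (𝓞 L))}
    (hSp : IsPAdicCMType p Sp) {ϑ : L} (hϑ₁ : ∀ σ : L →+* ℂ, (σ ϑ).re = 0)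
    (hϑ₂ : ∀ σ : L →+* ℂ, InSigma ι Sp σ → 0 < (σ ϑ).im)
    (hS : ∀ w ∈ S, ((p : ℕ) : 𝓞 L) ∉ w.asIdeal) (hTS : T ⊆ S)
    (hT : ∀ w ∈ T, IsCMField.complexConj L • w ≠ w ∧ IsCMField.complexConj L • w ∉ T)
    (hST : ∀ w ∈ S, IsCMField.complexConj L • w ≠ w → (w ∈ T ∨ IsCMField.complexConj L • w ∈ T))
    (hD₁ : primesOver L p ⊆ D) (hD₂ : S ⊆ D) (hD₃ : ∀ w ∈ S, IsCMField.complexConj L • w ∈ D)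
    (hD₄ : ∀ w : HeightOneSpectrum (𝓞 L),
      w.asIdeal.ramificationIdx (𝓞 (maximalRealSubfield L)) ≠ 1 → w ∈ D)
    (hd2 : ∀ w ∈ D, ordAt w (2 * ϑ) = differentExponentAt w) {lam : HeckeCharacter L}
    (hlam : ∀ w : HeightOneSpectrum (𝓞 L), w ∉ S → ((p : ℕ) : 𝓞 L) ∉ w.asIdeal →
      lam.IsUnramifiedAt w)
    {κ : ZpExtension K p}
    (hs : Function.Surjective (κ.toContinuousMonoidHom.comp (absGaloisRestrict K L)))
    {γ : absoluteGaloisGroup K} {γL : absoluteGaloisGroup L} (hγ : κ.IsTopGenerator γ)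
    (hγL : (κ.restrict L hs).IsTopGenerator γL) :
    ∃ (C : ℂ) (Ω : InfinitePlace L → ℂ) (Ωp : InfinitePlace L → ℂ_[p])
      (G : PowerSeries (PadicComplexInt p)),
      C ≠ 0 ∧ (∀ w, Ω w ≠ 0) ∧ (∀ w, ‖Ωp w‖ = 1) ∧ IsBaseChangeLine ι Sp S T κ γ lam ϑ C Ω Ωp G := by
  obtain ⟨C, Ω, Ωp, G, hC, hΩ, hΩp, hG⟩ :=
    exists_isLine (S := S) (T := T) h hp hunr hSp hϑ₁ hϑ₂ hS hTS hT hST hD₁ hD₂ hD₃ hD₄ hd2 hlam hγL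
  exact ⟨C, Ω, Ωp, G, hC, hΩ, hΩp,
    IsLine.isBaseChangeLine hA hs (ZpExtension.restrict_apply_eq_of_isTopGenerator κ L hs hγ hγL) hG⟩

end KatzCM

end BaseChangeLine

end Literature.NumberTheory.EllipticCurves

end
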